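import Mathlib
import Literature.Analysis.FluidPDE.VectorCalculus

/-!
# `SkeletonEquilibrium` (stmt-NavierStokesRegularity-15400): the curvature laws every witness obeys, I —
# first order, everywhere along the filament

Negative-side support for the crux `FilamentSkeletonRss.SkeletonEquilibrium` (leafhand
`leafhand-ns-filamentskeletonrs-21-g0`, 2026-08-31); the NORMAL/BINORMAL companions of the landed
`…Negative.StrainIdentity` (tangential part: `w′ = ½ + ⟪F′, Ξ′⟫`) and `…Negative.WaistTangentLaw`
(first order at a waist). Route-independent (no `Theses` import: the crux's clauses are restated as
hypotheses verbatim). Setting: a unit-speed `C²` curve `Ξ` carrying a differentiable induced velocity `F`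
(for the crux: the skeleton's regularised Biot–Savart velocity along the filament) with the tangency
relation `F(τ) + V_α(Ξ τ) = w(τ) Ξ′(τ)`, `V_α y = ½ y − α e₃ × y`, slip `w` differentiable.
Differentiating once gives the vector identity `F′ = w Ξ″ + w′ Ξ′ − V_α(Ξ′)` EVERYWHERE
(`hasDerivAt_induced`); its components off the tangent are new (no stagnation clause, every `τ`):

* `slip_mul_curvature_sq_eq` — `w ‖Ξ″‖² = ⟪F′, Ξ″⟫ − α ⟪e₃ × Ξ′, Ξ″⟫` (normal part): slip × curvature² is
  the normal along-filament shear of the induced velocity, corrected by the frame term;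
* `binormal_shear_eq` — `⟪F′, Ξ′ × Ξ″⟫ = −α ⟪e₃, Ξ″⟫` (binormal part, SLIP-FREE): wherever the curvature
  vector has a vertical component the induced velocity MUST shear binormally along the filament, at rate
  `−α Ξ″₃`, whatever induces `F`;
* `abs_slip_mul_curvature_le` — `|w| ‖Ξ″‖ ≤ ‖F′‖ + |α| ‖e₃ × Ξ′‖`: a curvature bound off the waist in terms
  of the shear and the tilt; `vertical_curvature_le` — `|α| |⟪e₃, Ξ″⟫| ≤ ‖F′‖ ‖Ξ″‖`: the inclination of
  the curvature vector off the horizontal is at most `‖F′‖/|α|` (so `F′(τ) = 0`, `α ≠ 0` ⇒ horizontal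
  curvature vector);
* `curvature_decay_far` (§3) — where `‖F‖ ≤ U`: `(‖Ξ‖/2 − U) ‖Ξ″‖ ≤ ‖F′‖ + |α| ‖e₃ × Ξ′‖`: outside the
  velocity ball the ends straighten, `κ ≤ 2(‖F′‖ + |α|)/(‖Ξ‖ − 2U)` (curvature companion of the radial /
  latitude / cone laws of `…LengthRegularRadial`, `…EndLatitude`, `…EndConeLaw`);
* `slip_smul_curvature_eq` (§4) — the curvature VECTOR law `w Ξ″ = F′ − ⟪F′, Ξ′⟫ Ξ′ − α e₃ × Ξ′` (exact, every
  `τ`): the filament's second-order ODE driven by the field's along-filament shear (the shadowing stubs' LIA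
  profile ODE `Y″ = (4π/γ) Y′ × V_α(Y)` is its local-induction closure);
* `witness_slip_mul_curvature_sq_eq`, `witness_binormal_shear_eq` — the same for the crux's own data
  (per-filament clauses + relative-equilibrium system, any `N, γ, α, Γ`; `F` = the skeleton velocity along
  filament `j`, differentiable because it equals `w_j Ξ_j′ − V_α(Ξ_j)`), unconditional.
Tools exported for part II (`…Negative.WaistCurvatureLaw`, second order at a waist): the drift derivative
`hasDerivAt_lerayDrift`, the product rule at a zero of the scalar factor `hasDerivAt_smul_of_eq_zero`,
`inner_deriv_deriv_two_eq_zero` (`⟪Ξ′, Ξ″⟫ = 0`) and `continuous_deriv_deriv_of_contDiff_two` (the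
coordinate identities stay `private`, as elsewhere in the tree).

Use for both sides of K1: off the waist the curvature of an equilibrium filament is read off from the
along-filament derivative of the induced velocity (`|w| κ ≤ ‖(u∘Ξ)′‖ + |α|·tilt`); a constructive witness
must realise binormal shear `−α Ξ″₃` along every filament. No stub of the registered lines is closed; no
summit statement is proved; NS regularity is not touched.
-/

set_option linter.dupNamespace false

namespace Summit.NavierStokesRegularity.NavierStokesRegularity.Theorems.SkeletonEquilibrium.Negative.CurvatureLaws

open Literature.Analysis.FluidPDE MeasureTheory Filter Topology
open scoped RealInnerProductSpace InnerProductSpace BigOperators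

/-! ## 0. Coordinate identities and two calculus lemmas -/

/-- `⟪a × b, b⟫ = 0` (private copy, as in the tree's other files). [folklore] -/
private theorem inner_cross_self_right_CL (a b : EuclideanSpace ℝ (Fin 3)) : ⟪cross a b, b⟫ = 0 := by
  simp only [cross, PiLp.inner_apply, RCLike.inner_apply, conj_trivial, Fin.sum_univ_three,
    cross_apply, Matrix.cons_val_zero, Matrix.cons_val_one, Matrix.cons_val_two,
    Matrix.head_cons, Matrix.tail_cons]
  ring

/-- `⟪a × b, a⟫ = 0`. [folklore] -/
private theorem inner_cross_self_left_CL (a b : EuclideanSpace ℝ (Fin 3)) : ⟪cross a b, a⟫ = 0 := by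
  simp only [cross, PiLp.inner_apply, RCLike.inner_apply, conj_trivial, Fin.sum_univ_three,
    cross_apply, Matrix.cons_val_zero, Matrix.cons_val_one, Matrix.cons_val_two,
    Matrix.head_cons, Matrix.tail_cons]
  ring

/-- Lagrange's identity `⟪a × b, c × d⟫ = ⟪a, c⟫ ⟪b, d⟫ − ⟪a, d⟫ ⟪b, c⟫`. [folklore] -/
private theorem inner_cross_cross_CL (a b c d : EuclideanSpace ℝ (Fin 3)) :
    ⟪cross a b, cross c d⟫ = ⟪a, c⟫ * ⟪b, d⟫ - ⟪a, d⟫ * ⟪b, c⟫ := by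
  simp only [cross, PiLp.inner_apply, RCLike.inner_apply, conj_trivial, Fin.sum_univ_three,
    cross_apply, Matrix.cons_val_zero, Matrix.cons_val_one, Matrix.cons_val_two,
    Matrix.head_cons, Matrix.tail_cons]
  ring

/-- `‖T × M‖² = ‖T‖² ‖M‖² − ⟪T, M⟫²`. [folklore] -/
private theorem norm_cross_sq_CL (T M : EuclideanSpace ℝ (Fin 3)) :
    ‖cross T M‖ ^ 2 = ‖T‖ ^ 2 * ‖M‖ ^ 2 - ⟪T, M⟫ ^ 2 := by
  rw [← real_inner_self_eq_norm_sq, inner_cross_cross_CL, real_inner_self_eq_norm_sq,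
    real_inner_self_eq_norm_sq, real_inner_comm T M]
  ring

/-- The drift `V_α(Ξ)` along a differentiable curve has derivative `V_α(Ξ′)` (exported copy of the
`private` lemma of `StrainIdentity`). [folklore] -/
theorem hasDerivAt_lerayDrift {α : ℝ} {Ξ : ℝ → EuclideanSpace ℝ (Fin 3)}
    {T : EuclideanSpace ℝ (Fin 3)} {τ : ℝ} (hΞ : HasDerivAt Ξ T τ) :
    HasDerivAt (fun σ => (1 / 2 : ℝ) • Ξ σ - α • cross (EuclideanSpace.single (2 : Fin 3) (1 : ℝ)) (Ξ σ))
      ((1 / 2 : ℝ) • T - α • cross (EuclideanSpace.single (2 : Fin 3) (1 : ℝ)) T) τ := by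
  have h2 : HasDerivAt (fun σ => cross (EuclideanSpace.single (2 : Fin 3) (1 : ℝ)) (Ξ σ))
      (cross (EuclideanSpace.single (2 : Fin 3) (1 : ℝ)) T) τ := by
    have h := (crossCLM (EuclideanSpace.single (2 : Fin 3) (1 : ℝ))).hasFDerivAt.comp_hasDerivAt τ hΞ
    simpa [Function.comp_def, crossCLM_apply] using h
  exact (hΞ.const_smul (1 / 2 : ℝ)).sub (h2.const_smul α)

/-- Product rule at a zero of the scalar factor: if `f(τ*) = 0`, `f` has derivative `f′` at `τ*` and `g`
is merely CONTINUOUS at `τ*`, then `f • g` has derivative `f′ • g(τ*)` at `τ*`. [folklore] -/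
theorem hasDerivAt_smul_of_eq_zero {f : ℝ → ℝ} {g : ℝ → EuclideanSpace ℝ (Fin 3)}
    {f' τs : ℝ} (hf : HasDerivAt f f' τs) (hz : f τs = 0) (hg : ContinuousAt g τs) :
    HasDerivAt (fun τ => f τ • g τ) (f' • g τs) τs := by
  rw [hasDerivAt_iff_tendsto_slope] at hf ⊢
  have hslope : slope (fun τ => f τ • g τ) τs = fun τ => slope f τs τ • g τ := by
    funext τ
    simp only [slope_def_module, hz, zero_smul, sub_zero, smul_eq_mul, smul_smul]
  rw [hslope]
  exact hf.smul (hg.tendsto.mono_left nhdsWithin_le_nhds)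

/-- Unit speed forces `⟪Ξ′, Ξ″⟫ = 0`. [folklore] -/
theorem inner_deriv_deriv_two_eq_zero {Ξ : ℝ → EuclideanSpace ℝ (Fin 3)} (hΞ : ContDiff ℝ 2 Ξ)
    (hunit : ∀ τ, ‖deriv Ξ τ‖ = 1) (τ : ℝ) : ⟪deriv Ξ τ, deriv (deriv Ξ) τ⟫ = 0 := by
  have hTd : Differentiable ℝ (deriv Ξ) := hΞ.differentiable_deriv_two
  have h1 : (fun σ => ⟪deriv Ξ σ, deriv Ξ σ⟫) = fun _ => (1 : ℝ) := by
    funext σ; rw [real_inner_self_eq_norm_sq, hunit σ, one_pow]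
  have h2 : HasDerivAt (fun σ => ⟪deriv Ξ σ, deriv Ξ σ⟫)
      (⟪deriv Ξ τ, deriv (deriv Ξ) τ⟫ + ⟪deriv (deriv Ξ) τ, deriv Ξ τ⟫) τ :=
    (hTd τ).hasDerivAt.inner ℝ (hTd τ).hasDerivAt
  rw [h1] at h2
  have h3 := h2.unique (hasDerivAt_const τ (1 : ℝ))
  rw [real_inner_comm (deriv (deriv Ξ) τ)] at h3 ⊢
  linarith

/-- `C²` gives a continuous second derivative. [folklore] -/
theorem continuous_deriv_deriv_of_contDiff_two {Ξ : ℝ → EuclideanSpace ℝ (Fin 3)} (hΞ : ContDiff ℝ 2 Ξ) :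
    Continuous (deriv (deriv Ξ)) := by
  have h2 : ContDiff ℝ ((1 : WithTop ℕ∞) + 1) Ξ := by rwa [one_add_one_eq_two]
  exact h2.deriv'.continuous_deriv le_rfl

/-! ## 1. First order, everywhere along the filament -/

/-- **The differentiated tangency relation.** Under `F + V_α(Ξ) = w Ξ′` (`Ξ ∈ C²`, `F`, `w`
differentiable): `F′(τ) = w(τ) Ξ″(τ) + w′(τ) Ξ′(τ) − V_α(Ξ′(τ))` for every `τ`. [folklore] -/
theorem hasDerivAt_induced {α : ℝ} {Ξ F : ℝ → EuclideanSpace ℝ (Fin 3)} {w : ℝ → ℝ}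
    (hΞ : ContDiff ℝ 2 Ξ) (hw : Differentiable ℝ w)
    (heq : ∀ τ, F τ + ((1 / 2 : ℝ) • Ξ τ - α • cross (EuclideanSpace.single (2 : Fin 3) (1 : ℝ)) (Ξ τ)) =
      w τ • deriv Ξ τ) (τ : ℝ) :
    HasDerivAt F (w τ • deriv (deriv Ξ) τ + deriv w τ • deriv Ξ τ -
      ((1 / 2 : ℝ) • deriv Ξ τ - α • cross (EuclideanSpace.single (2 : Fin 3) (1 : ℝ)) (deriv Ξ τ))) τ := by
  have hd : Differentiable ℝ Ξ := hΞ.differentiable (by norm_num)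
  have hd' : Differentiable ℝ (deriv Ξ) := hΞ.differentiable_deriv_two
  have hFfun : F = fun τ => w τ • deriv Ξ τ -
      ((1 / 2 : ℝ) • Ξ τ - α • cross (EuclideanSpace.single (2 : Fin 3) (1 : ℝ)) (Ξ τ)) := by
    funext τ; rw [← heq τ, add_sub_cancel_right]
  rw [hFfun]
  exact ((hw τ).hasDerivAt.smul (hd' τ).hasDerivAt).sub (hasDerivAt_lerayDrift (hd τ).hasDerivAt)

/-- **Slip × curvature² law (normal component, every `τ`).** Under the tangency relation with
`‖Ξ′‖ ≡ 1`: `w(τ) ‖Ξ″(τ)‖² = ⟪F′(τ), Ξ″(τ)⟫ − α ⟪e₃ × Ξ′(τ), Ξ″(τ)⟫`. Off the waist the curvature is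
the normal along-filament shear of the total velocity divided by the slip. [folklore] -/
theorem slip_mul_curvature_sq_eq {α : ℝ} {Ξ F : ℝ → EuclideanSpace ℝ (Fin 3)} {w : ℝ → ℝ}
    (hΞ : ContDiff ℝ 2 Ξ) (hunit : ∀ τ, ‖deriv Ξ τ‖ = 1) (hw : Differentiable ℝ w)
    (heq : ∀ τ, F τ + ((1 / 2 : ℝ) • Ξ τ - α • cross (EuclideanSpace.single (2 : Fin 3) (1 : ℝ)) (Ξ τ)) =
      w τ • deriv Ξ τ) (τ : ℝ) :
    w τ * ‖deriv (deriv Ξ) τ‖ ^ 2 = ⟪deriv F τ, deriv (deriv Ξ) τ⟫ -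
      α * ⟪cross (EuclideanSpace.single (2 : Fin 3) (1 : ℝ)) (deriv Ξ τ), deriv (deriv Ξ) τ⟫ := by
  have hTM : ⟪deriv Ξ τ, deriv (deriv Ξ) τ⟫ = 0 := inner_deriv_deriv_two_eq_zero hΞ hunit τ
  rw [(hasDerivAt_induced hΞ hw heq τ).deriv, inner_sub_left, inner_add_left, inner_sub_left,
    real_inner_smul_left, real_inner_smul_left, real_inner_smul_left, real_inner_smul_left, hTM,
    real_inner_self_eq_norm_sq]
  ring

/-- **Binormal shear law (binormal component, every `τ`; slip-free).** Under the tangency relation with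
`‖Ξ′‖ ≡ 1`: `⟪F′(τ), Ξ′(τ) × Ξ″(τ)⟫ = −α ⟪e₃, Ξ″(τ)⟫`. [folklore] -/
theorem binormal_shear_eq {α : ℝ} {Ξ F : ℝ → EuclideanSpace ℝ (Fin 3)} {w : ℝ → ℝ}
    (hΞ : ContDiff ℝ 2 Ξ) (hunit : ∀ τ, ‖deriv Ξ τ‖ = 1) (hw : Differentiable ℝ w)
    (heq : ∀ τ, F τ + ((1 / 2 : ℝ) • Ξ τ - α • cross (EuclideanSpace.single (2 : Fin 3) (1 : ℝ)) (Ξ τ)) =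
      w τ • deriv Ξ τ) (τ : ℝ) :
    ⟪deriv F τ, cross (deriv Ξ τ) (deriv (deriv Ξ) τ)⟫ =
      -α * ⟪EuclideanSpace.single (2 : Fin 3) (1 : ℝ), deriv (deriv Ξ) τ⟫ := by
  have hTM : ⟪deriv Ξ τ, deriv (deriv Ξ) τ⟫ = 0 := inner_deriv_deriv_two_eq_zero hΞ hunit τ
  have hTT : ⟪deriv Ξ τ, deriv Ξ τ⟫ = 1 := by
    rw [real_inner_self_eq_norm_sq, hunit τ, one_pow]
  have hM : ⟪deriv (deriv Ξ) τ, cross (deriv Ξ τ) (deriv (deriv Ξ) τ)⟫ = 0 := by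
    rw [real_inner_comm]; exact inner_cross_self_right_CL _ _
  have hT : ⟪deriv Ξ τ, cross (deriv Ξ τ) (deriv (deriv Ξ) τ)⟫ = 0 := by
    rw [real_inner_comm]; exact inner_cross_self_left_CL _ _
  rw [(hasDerivAt_induced hΞ hw heq τ).deriv, inner_sub_left, inner_add_left, inner_sub_left,
    real_inner_smul_left, real_inner_smul_left, real_inner_smul_left, real_inner_smul_left, hM, hT,
    inner_cross_cross_CL, hTT, hTM]
  ring

/-- **Curvature bound off the waist.** Under the tangency relation with `‖Ξ′‖ ≡ 1`:
`|w(τ)| ‖Ξ″(τ)‖ ≤ ‖F′(τ)‖ + |α| ‖e₃ × Ξ′(τ)‖` for every `τ`. [folklore] -/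
theorem abs_slip_mul_curvature_le {α : ℝ} {Ξ F : ℝ → EuclideanSpace ℝ (Fin 3)} {w : ℝ → ℝ}
    (hΞ : ContDiff ℝ 2 Ξ) (hunit : ∀ τ, ‖deriv Ξ τ‖ = 1) (hw : Differentiable ℝ w)
    (heq : ∀ τ, F τ + ((1 / 2 : ℝ) • Ξ τ - α • cross (EuclideanSpace.single (2 : Fin 3) (1 : ℝ)) (Ξ τ)) =
      w τ • deriv Ξ τ) (τ : ℝ) :
    |w τ| * ‖deriv (deriv Ξ) τ‖ ≤
      ‖deriv F τ‖ + |α| * ‖cross (EuclideanSpace.single (2 : Fin 3) (1 : ℝ)) (deriv Ξ τ)‖ := by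
  set M := deriv (deriv Ξ) τ with hMdef
  set C := cross (EuclideanSpace.single (2 : Fin 3) (1 : ℝ)) (deriv Ξ τ) with hCdef
  have h := slip_mul_curvature_sq_eq hΞ hunit hw heq τ
  rw [← hMdef, ← hCdef] at h
  have h1 : |⟪deriv F τ, M⟫| ≤ ‖deriv F τ‖ * ‖M‖ := abs_real_inner_le_norm _ _
  have h2 : |⟪C, M⟫| ≤ ‖C‖ * ‖M‖ := abs_real_inner_le_norm _ _
  have hkey : |w τ| * ‖M‖ ^ 2 ≤ (‖deriv F τ‖ + |α| * ‖C‖) * ‖M‖ := by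
    have : |w τ| * ‖M‖ ^ 2 = |⟪deriv F τ, M⟫ - α * ⟪C, M⟫| := by
      rw [← h, abs_mul, abs_of_nonneg (sq_nonneg ‖M‖)]
    rw [this]
    calc |⟪deriv F τ, M⟫ - α * ⟪C, M⟫| ≤ |⟪deriv F τ, M⟫| + |α * ⟪C, M⟫| := abs_sub _ _
      _ = |⟪deriv F τ, M⟫| + |α| * |⟪C, M⟫| := by rw [abs_mul]
      _ ≤ ‖deriv F τ‖ * ‖M‖ + |α| * (‖C‖ * ‖M‖) := by gcongr
      _ = (‖deriv F τ‖ + |α| * ‖C‖) * ‖M‖ := by ring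
  by_cases hM : ‖M‖ = 0
  · rw [hM, mul_zero]; positivity
  · have hMpos : 0 < ‖M‖ := lt_of_le_of_ne (norm_nonneg _) (Ne.symm hM)
    have : |w τ| * ‖M‖ * ‖M‖ ≤ (‖deriv F τ‖ + |α| * ‖C‖) * ‖M‖ := by rw [mul_assoc, ← sq]; exact hkey
    exact le_of_mul_le_mul_right this hMpos

/-- **Vertical curvature is paid for by shear.** Under the tangency relation with `‖Ξ′‖ ≡ 1`:
`|α| |⟪e₃, Ξ″(τ)⟫| ≤ ‖F′(τ)‖ ‖Ξ″(τ)‖` for every `τ` (from `binormal_shear_eq` and `‖Ξ′ × Ξ″‖ = ‖Ξ″‖`;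
when `Ξ″(τ) ≠ 0` this bounds the inclination of the curvature vector, `|α| |cos ∠(e₃, Ξ″)| ≤ ‖F′‖`).
In particular, if `α ≠ 0` and `F′(τ) = 0`, the curvature vector at `τ` is horizontal. [folklore] -/
theorem vertical_curvature_le {α : ℝ} {Ξ F : ℝ → EuclideanSpace ℝ (Fin 3)} {w : ℝ → ℝ}
    (hΞ : ContDiff ℝ 2 Ξ) (hunit : ∀ τ, ‖deriv Ξ τ‖ = 1) (hw : Differentiable ℝ w)
    (heq : ∀ τ, F τ + ((1 / 2 : ℝ) • Ξ τ - α • cross (EuclideanSpace.single (2 : Fin 3) (1 : ℝ)) (Ξ τ)) =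
      w τ • deriv Ξ τ) (τ : ℝ) :
    |α| * |⟪EuclideanSpace.single (2 : Fin 3) (1 : ℝ), deriv (deriv Ξ) τ⟫| ≤
      ‖deriv F τ‖ * ‖deriv (deriv Ξ) τ‖ := by
  set M := deriv (deriv Ξ) τ with hMdef
  set T := deriv Ξ τ with hTdef
  have h := binormal_shear_eq hΞ hunit hw heq τ
  rw [← hMdef, ← hTdef] at h
  have hTM : ⟪T, M⟫ = 0 := inner_deriv_deriv_two_eq_zero hΞ hunit τ
  have hnorm : ‖cross T M‖ = ‖M‖ := by
    have h2 : ‖cross T M‖ ^ 2 = ‖M‖ ^ 2 := by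
      rw [norm_cross_sq_CL, hTdef, hunit τ, ← hTdef, hTM]; ring
    exact (sq_eq_sq₀ (norm_nonneg _) (norm_nonneg _)).1 h2
  have h1 : |⟪deriv F τ, cross T M⟫| ≤ ‖deriv F τ‖ * ‖cross T M‖ := abs_real_inner_le_norm _ _
  rw [h, hnorm, abs_mul, abs_neg] at h1
  exact h1

/-! ## 2. The crux's own data -/

/-- **Every witness of the crux obeys the slip × curvature² law.** From the per-filament clauses (C²,
unit speed, `w_j` differentiable) and the relative-equilibrium system of `SkeletonEquilibrium` (any
`N, γ, α, Γ`), for every filament `j` and every `τ`: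
`w_j(τ) ‖Ξ_j″(τ)‖² = ⟪(u_skel ∘ Ξ_j)′(τ), Ξ_j″(τ)⟫ − α ⟪e₃ × Ξ_j′(τ), Ξ_j″(τ)⟫`. [folklore] -/
theorem witness_slip_mul_curvature_sq_eq {N : ℕ} {γ : Fin N → ℝ} {α Γ : ℝ}
    {Ξ : Fin N → ℝ → EuclideanSpace ℝ (Fin 3)} {w : Fin N → ℝ → ℝ}
    (hC2 : ∀ j, ContDiff ℝ 2 (Ξ j)) (hunit : ∀ j τ, ‖deriv (Ξ j) τ‖ = 1)
    (hw : ∀ j, Differentiable ℝ (w j))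
    (heq : ∀ j τ, (∑ k : Fin N, (Γ * γ k / (4 * Real.pi)) • ∫ σ : ℝ,
      ((‖Ξ j τ - Ξ k σ‖ ^ 2 + 1) ^ (3 / 2 : ℝ))⁻¹ • cross (deriv (Ξ k) σ) (Ξ j τ - Ξ k σ)) +
      (1 / 2 : ℝ) • Ξ j τ - α • cross (EuclideanSpace.single (2 : Fin 3) (1 : ℝ)) (Ξ j τ) =
      w j τ • deriv (Ξ j) τ)
    (j : Fin N) (τ : ℝ) :
    w j τ * ‖deriv (deriv (Ξ j)) τ‖ ^ 2 =
      ⟪deriv (fun τ => ∑ k : Fin N, (Γ * γ k / (4 * Real.pi)) • ∫ σ : ℝ,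
        ((‖Ξ j τ - Ξ k σ‖ ^ 2 + 1) ^ (3 / 2 : ℝ))⁻¹ • cross (deriv (Ξ k) σ) (Ξ j τ - Ξ k σ)) τ,
        deriv (deriv (Ξ j)) τ⟫ -
      α * ⟪cross (EuclideanSpace.single (2 : Fin 3) (1 : ℝ)) (deriv (Ξ j) τ), deriv (deriv (Ξ j)) τ⟫ := by
  have heq' : ∀ τ, (fun τ => ∑ k : Fin N, (Γ * γ k / (4 * Real.pi)) • ∫ σ : ℝ,
      ((‖Ξ j τ - Ξ k σ‖ ^ 2 + 1) ^ (3 / 2 : ℝ))⁻¹ • cross (deriv (Ξ k) σ) (Ξ j τ - Ξ k σ)) τ +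
      ((1 / 2 : ℝ) • Ξ j τ - α • cross (EuclideanSpace.single (2 : Fin 3) (1 : ℝ)) (Ξ j τ)) =
      w j τ • deriv (Ξ j) τ := fun τ => by rw [← heq j τ, add_sub_assoc]
  exact slip_mul_curvature_sq_eq (hC2 j) (hunit j) (hw j) heq' τ

/-- **Every witness of the crux obeys the binormal shear law (slip-free).** Same data: for every filament
`j` and every `τ`, `⟪(u_skel ∘ Ξ_j)′(τ), Ξ_j′(τ) × Ξ_j″(τ)⟫ = −α ⟪e₃, Ξ_j″(τ)⟫`: the skeleton velocity
shears binormally along each filament exactly at the rate `−α × (vertical curvature)`. [folklore] -/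
theorem witness_binormal_shear_eq {N : ℕ} {γ : Fin N → ℝ} {α Γ : ℝ}
    {Ξ : Fin N → ℝ → EuclideanSpace ℝ (Fin 3)} {w : Fin N → ℝ → ℝ}
    (hC2 : ∀ j, ContDiff ℝ 2 (Ξ j)) (hunit : ∀ j τ, ‖deriv (Ξ j) τ‖ = 1)
    (hw : ∀ j, Differentiable ℝ (w j))
    (heq : ∀ j τ, (∑ k : Fin N, (Γ * γ k / (4 * Real.pi)) • ∫ σ : ℝ,
      ((‖Ξ j τ - Ξ k σ‖ ^ 2 + 1) ^ (3 / 2 : ℝ))⁻¹ • cross (deriv (Ξ k) σ) (Ξ j τ - Ξ k σ)) +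
      (1 / 2 : ℝ) • Ξ j τ - α • cross (EuclideanSpace.single (2 : Fin 3) (1 : ℝ)) (Ξ j τ) =
      w j τ • deriv (Ξ j) τ)
    (j : Fin N) (τ : ℝ) :
    ⟪deriv (fun τ => ∑ k : Fin N, (Γ * γ k / (4 * Real.pi)) • ∫ σ : ℝ,
        ((‖Ξ j τ - Ξ k σ‖ ^ 2 + 1) ^ (3 / 2 : ℝ))⁻¹ • cross (deriv (Ξ k) σ) (Ξ j τ - Ξ k σ)) τ,
      cross (deriv (Ξ j) τ) (deriv (deriv (Ξ j)) τ)⟫ =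
      -α * ⟪EuclideanSpace.single (2 : Fin 3) (1 : ℝ), deriv (deriv (Ξ j)) τ⟫ := by
  have heq' : ∀ τ, (fun τ => ∑ k : Fin N, (Γ * γ k / (4 * Real.pi)) • ∫ σ : ℝ,
      ((‖Ξ j τ - Ξ k σ‖ ^ 2 + 1) ^ (3 / 2 : ℝ))⁻¹ • cross (deriv (Ξ k) σ) (Ξ j τ - Ξ k σ)) τ +
      ((1 / 2 : ℝ) • Ξ j τ - α • cross (EuclideanSpace.single (2 : Fin 3) (1 : ℝ)) (Ξ j τ)) =
      w j τ • deriv (Ξ j) τ := fun τ => by rw [← heq j τ, add_sub_assoc]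
  exact binormal_shear_eq (hC2 j) (hunit j) (hw j) heq' τ

/-! ## 3. Outside the velocity ball: the ends straighten -/

/-- **Curvature decay far out.** Under the tangency relation with `‖Ξ′‖ ≡ 1`, at a point where the
induced velocity is bounded, `‖F(τ)‖ ≤ U`:
`(‖Ξ(τ)‖/2 − U) ‖Ξ″(τ)‖ ≤ ‖F′(τ)‖ + |α| ‖e₃ × Ξ′(τ)‖` (`≤ ‖F′(τ)‖ + |α|`). Indeed the slip is the norm
of the total velocity, `|w| = ‖F + V_α(Ξ)‖ ≥ ‖V_α(Ξ)‖ − ‖F‖ ≥ ‖Ξ‖/2 − U`, and `abs_slip_mul_curvature_le`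
applies: outside the velocity ball `‖Ξ‖ ≤ 2U` an equilibrium filament STRAIGHTENS at the rate
`κ ≤ 2(‖F′‖ + |α|)/(‖Ξ‖ − 2U)` — the curvature companion of the radial / latitude / cone laws of the
ends (`…LengthRegularRadial`, `…EndLatitude`, `…EndConeLaw`), with the along-filament shear `‖F′‖` in
place of the velocity bound alone. [folklore] -/
theorem curvature_decay_far {α : ℝ} {Ξ F : ℝ → EuclideanSpace ℝ (Fin 3)} {w : ℝ → ℝ}
    (hΞ : ContDiff ℝ 2 Ξ) (hunit : ∀ τ, ‖deriv Ξ τ‖ = 1) (hw : Differentiable ℝ w)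
    (heq : ∀ τ, F τ + ((1 / 2 : ℝ) • Ξ τ - α • cross (EuclideanSpace.single (2 : Fin 3) (1 : ℝ)) (Ξ τ)) =
      w τ • deriv Ξ τ) {τ U : ℝ} (hU : ‖F τ‖ ≤ U) :
    (‖Ξ τ‖ / 2 - U) * ‖deriv (deriv Ξ) τ‖ ≤
      ‖deriv F τ‖ + |α| * ‖cross (EuclideanSpace.single (2 : Fin 3) (1 : ℝ)) (deriv Ξ τ)‖ := by
  have h := abs_slip_mul_curvature_le hΞ hunit hw heq τ
  set V := (1 / 2 : ℝ) • Ξ τ - α • cross (EuclideanSpace.single (2 : Fin 3) (1 : ℝ)) (Ξ τ) with hV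
  -- `‖V_α(Ξ)‖ ≥ ‖Ξ‖/2`, from `⟪V_α(Ξ), Ξ⟫ = ‖Ξ‖²/2`
  have hVΞ : ⟪V, Ξ τ⟫ = ‖Ξ τ‖ ^ 2 / 2 := by
    rw [hV, inner_sub_left, real_inner_smul_left, real_inner_smul_left, inner_cross_self_right_CL,
      mul_zero, sub_zero, real_inner_self_eq_norm_sq]
    ring
  have hVge : ‖Ξ τ‖ / 2 ≤ ‖V‖ := by
    by_cases h0 : ‖Ξ τ‖ = 0
    · rw [h0, zero_div]; exact norm_nonneg _
    · have hpos : 0 < ‖Ξ τ‖ := lt_of_le_of_ne (norm_nonneg _) (Ne.symm h0)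
      have h1 : ⟪V, Ξ τ⟫ ≤ ‖V‖ * ‖Ξ τ‖ := real_inner_le_norm _ _
      rw [hVΞ] at h1
      have h2 : ‖Ξ τ‖ / 2 * ‖Ξ τ‖ ≤ ‖V‖ * ‖Ξ τ‖ := by
        calc ‖Ξ τ‖ / 2 * ‖Ξ τ‖ = ‖Ξ τ‖ ^ 2 / 2 := by ring
          _ ≤ ‖V‖ * ‖Ξ τ‖ := h1
      exact le_of_mul_le_mul_right h2 hpos
  -- `|w| = ‖F + V_α(Ξ)‖ ≥ ‖V_α(Ξ)‖ − ‖F‖`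
  have hwabs : |w τ| = ‖F τ + V‖ := by
    rw [hV, heq τ, norm_smul, Real.norm_eq_abs, hunit τ, mul_one]
  have hVle : ‖V‖ ≤ ‖F τ + V‖ + ‖F τ‖ := by
    calc ‖V‖ = ‖(F τ + V) - F τ‖ := by rw [add_sub_cancel_left]
      _ ≤ ‖F τ + V‖ + ‖F τ‖ := norm_sub_le _ _
  have hlow : ‖Ξ τ‖ / 2 - U ≤ |w τ| := by rw [hwabs]; linarith
  calc (‖Ξ τ‖ / 2 - U) * ‖deriv (deriv Ξ) τ‖ ≤ |w τ| * ‖deriv (deriv Ξ) τ‖ :=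
        mul_le_mul_of_nonneg_right hlow (norm_nonneg _)
    _ ≤ ‖deriv F τ‖ + |α| * ‖cross (EuclideanSpace.single (2 : Fin 3) (1 : ℝ)) (deriv Ξ τ)‖ := h

/-! ## 4. The curvature VECTOR law (slip × curvature vector = normal shear − frame term) -/

/-- **Curvature vector law (exact, every `τ`).** Under the tangency relation with `‖Ξ′‖ ≡ 1`:
`w(τ) Ξ″(τ) = F′(τ) − ⟪F′(τ), Ξ′(τ)⟫ Ξ′(τ) − α e₃ × Ξ′(τ)` — the slip times the curvature VECTOR is the
normal part of the along-filament derivative of the induced velocity minus the frame rotation of the tangent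
(the vector whose `Ξ″`- and `Ξ′ × Ξ″`-components are `slip_mul_curvature_sq_eq` and `binormal_shear_eq`; with
the strain identity `w′ = ½ + ⟪F′, Ξ′⟫` it is the full differentiated tangency relation). Off the waist this
IS the filament's second-order ODE driven by the field's shear; compare the LIA profile ODE
`Y″ = (4π/γ) Y′ × V_α(Y)` of the shadowing stubs, which replaces `F′` by the local-induction closure. [folklore] -/
theorem slip_smul_curvature_eq {α : ℝ} {Ξ F : ℝ → EuclideanSpace ℝ (Fin 3)} {w : ℝ → ℝ}
    (hΞ : ContDiff ℝ 2 Ξ) (hunit : ∀ τ, ‖deriv Ξ τ‖ = 1) (hw : Differentiable ℝ w)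
    (heq : ∀ τ, F τ + ((1 / 2 : ℝ) • Ξ τ - α • cross (EuclideanSpace.single (2 : Fin 3) (1 : ℝ)) (Ξ τ)) =
      w τ • deriv Ξ τ) (τ : ℝ) :
    w τ • deriv (deriv Ξ) τ = deriv F τ - ⟪deriv F τ, deriv Ξ τ⟫ • deriv Ξ τ -
      α • cross (EuclideanSpace.single (2 : Fin 3) (1 : ℝ)) (deriv Ξ τ) := by
  have hder := (hasDerivAt_induced hΞ hw heq τ).deriv
  have hTM : ⟪deriv Ξ τ, deriv (deriv Ξ) τ⟫ = 0 := inner_deriv_deriv_two_eq_zero hΞ hunit τ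
  have hTT : ⟪deriv Ξ τ, deriv Ξ τ⟫ = 1 := by
    rw [real_inner_self_eq_norm_sq, hunit τ, one_pow]
  -- the tangential component of `F′` is `w′ − ½` (strain identity, re-derived from `hder`)
  have htan : ⟪deriv F τ, deriv Ξ τ⟫ = deriv w τ - 1 / 2 := by
    rw [hder, inner_sub_left, inner_add_left, inner_sub_left, real_inner_smul_left, real_inner_smul_left,
      real_inner_smul_left, real_inner_smul_left, real_inner_comm (deriv Ξ τ) (deriv (deriv Ξ) τ), hTM,
      hTT, inner_cross_self_right_CL]
    ring
  rw [htan, hder]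
  module

end Summit.NavierStokesRegularity.NavierStokesRegularity.Theorems.SkeletonEquilibrium.Negative.CurvatureLaws
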